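import Summits.BirchSwinnertonDyer.BirchSwinnertonDyer.Theorems.GoldfeldAllTwistsTwoConverseTwinEtaDescentArithmetic
import Literature.NumberTheory.EllipticCurves.X049EtaDescentNormProofs
import HarnessLib

set_option linter.dupNamespace false -- namespace `…BirchSwinnertonDyer.BirchSwinnertonDyer…` is the cell's (D-0017 nested layout)
set_option autoImplicit false

/-!
# LINE B⁗, file X2: the PARTIAL-NORM KEY LEMMA — `7 · ∏_{τ ∈ S} τ(x(y₁) − 2)` is never a square in the Hilbert class field `K[1]`,
# for every finite set `S` of `K`-automorphisms (the genus-coset differences of the quarter trace are their obvious halves)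

Cell `bsd-goldfeld`, seat `bsd-goldfeld-s1p-c3x` (gen 10); planner ORDER (ccxcix) «LINE B⁗ FILES — TRANCHE 1», object X2 (the stop/go test of
the χ_Z line; memo `HOME/B4-SIGNATURES.md` §2 (L)). `--supports stmt-BirchSwinnertonDyer-19140` as a HELPER (twin″, formula axis of
`49a1^{(−2qp)}`). Theses-free; theorems only; no definition, no `sorry`, no new fact.

WHY. In the χ_Z bookkeeping (file X4 `…ChiZCore`, hypothesis `hKey`) the genus-coset difference `σΨ − Ψ` of the quarter trace is torsion
away from its obvious half `−2(M/M_e)•R_e − 2(M/M_p)•R_p`, and the `2`-part `[η]₂ ∈ {O, T}` of that torsion is `T` iff the `x − 2` descent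
class of `σΨ − Ψ` is `[7]`, i.e. iff `7 · ∏_{τ ∈ H}(τ x₁ − 2)` is a square in `K[1]` (`H` = the index-two subgroup `Gal(K[1]/J^σ)`; K8's
descent lemma). THIS FILE kills that possibility for EVERY finite `S ⊆ Gal(K[1]/K)`, by A‴'s K3 valuation argument one level up — no class
group, no units: by (F-η)+(F-D) `x₁ − 2 = u` with `(u) = 𝔮̄′𝓞_{K[1]}` for a prime `𝔮̄′ ∋ 7` of `𝓞_K`; by (F-norm) there is ANOTHER prime
`𝔮 ∋ 7` of `𝓞_K` with `7 ∉ 𝔮²` (`N(u) ∉ 𝔮`, while `N(u) ∈ 𝔮̄′`); `K[1]/K` is unramified at `𝔮` (conductor `1`), so at a prime `𝔔 ∣ 𝔮` of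
`K[1]`: `v_𝔔(7) = 1` and `v_𝔔(τu) = 0` (else `𝔮̄′ ⊆ 𝔔 ∩ 𝓞_K = 𝔮`), whence `v_𝔔(7∏τu)` is odd and `7∏τu` is not a square.
* §1 `not_isSquare_of_valuation_eq_exp_odd` (Dedekind, abstract); §2 `not_isSquare_seven_mul_prod_mapAlgEquiv` (the lemma over `𝓞_K ⊂ 𝓞_{K[1]}`
  from `(u) = 𝔮̄′𝓞`, `𝔮 ≠ 𝔮̄′`, `7 ∈ 𝔮 ∖ 𝔮²`); §3 `exists_heegner_x_not_isSquare_seven_mul_prod` — the Heegner instance: binders (F-η)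
  `x049_x_sub_two_eq_etaQuotient`, (F-D) `deuring_etaQuotient49_heegner_generates_conjPrime`, (F-norm) `x049_heegner_norm_x_sub_two_not_mem` BY
  NAME (pre-existing Literature facts; (F-norm) is derived from the first two in `X049EtaDescentNormProofs`, used here only for the second prime).
Numerics (memo §3 (c3), kit j304854): the partial norms `N_{K[1]/J_i}(x(y₁) − 2)` to the three quadratic steps are squares in `J_i` on 162/162 rows.
HONEST FRAMING: an ideal-theoretic lemma about a CM value; no Heegner point is shown non-torsion or non-divisible here; items 19140 / 19350 /
20044 unchanged; BSD is not proved by any of this.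

References: [Lang1987] Ch. 12 §2 Thm. 4–5; [Ligozat1975] Prop. 3.1.1; [Gross1984] §§4–5; [Cox2013] §9.A; [NeukirchANT1999] II (8.5).
-/

noncomputable section

open scoped Classical

open IsDedekindDomain IsDedekindDomain.HeightOneSpectrum NumberField WithZero WeierstrassCurve
open Literature.NumberTheory.EllipticCurves Literature.NumberTheory.EllipticCurves.ModularForms

namespace Summit.BirchSwinnertonDyer.BirchSwinnertonDyer.Theorems.GoldfeldGoodTwists

/-! ## §1 Odd valuation ⟹ not a square (abstract Dedekind) -/
section Valuation

variable {B : Type*} (L : Type*) [CommRing B] [IsDedekindDomain B] [Field L] [Algebra B L] [IsFractionRing B L]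

/-- If `w(x) = exp m` with `m` odd then `x` is not a square in `L` (the valuation of a square is `exp` of an even integer).
[cite: NeukirchANT1999, II (8.5)] -/
theorem not_isSquare_of_valuation_eq_exp_odd (w : HeightOneSpectrum B) {x : L} {m : ℤ} (hm : Odd m)
    (hx : w.valuation L x = exp m) : ¬ IsSquare x := by
  rintro ⟨s, hs⟩
  rw [hs, map_mul] at hx
  have hs0 : w.valuation L s ≠ 0 := by
    intro h0
    rw [h0, mul_zero] at hx
    exact exp_ne_zero hx.symm
  rw [← exp_log hs0, ← exp_add, exp_inj] at hx
  obtain ⟨k, hk⟩ := hm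
  omega

end Valuation

/-! ## §2 The lemma over `𝓞_K ⊂ 𝓞_{K[1]}` -/
section RingClassField

variable {K : Type} [Field K] [NumberField K]

/-- **`7 · ∏_{τ ∈ S} τu` is not a square in `K[1]`.** `K` imaginary quadratic, `u ∈ 𝓞_{K[1]}` with `(u) = 𝔮̄′𝓞_{K[1]}` for a prime `𝔮̄′` of
`𝓞_K`, and `𝔮 ≠ 𝔮̄′` a prime of `𝓞_K` with `7 ∈ 𝔮 ∖ 𝔮²`: for every finite set `S` of `K`-automorphisms of `K[1]`, `7 · ∏_{τ∈S} τu ∉ K[1]^{×2}`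
(valuation `1 + 0` at a prime of `K[1]` over the unramified `𝔮`). [cite: Cox2013, §9.A (p. 181)] [cite: NeukirchANT1999, II (8.5)] -/
theorem not_isSquare_seven_mul_prod_mapAlgEquiv (hK : IsImaginaryQuadratic K) (ι : K →+* ℂ)
    [FiniteDimensional K (ringClassField K ι 1)] (u : 𝓞 (ringClassField K ι 1)) (v' v : HeightOneSpectrum (𝓞 K))
    (hspan : Ideal.span {u} = v'.asIdeal.map (algebraMap (𝓞 K) (𝓞 (ringClassField K ι 1))))
    (hne : v.asIdeal ≠ v'.asIdeal) (h7v : (7 : 𝓞 K) ∈ v.asIdeal) (h7v2 : (7 : 𝓞 K) ∉ v.asIdeal ^ 2)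
    (S : Finset (ringClassField K ι 1 ≃ₐ[K] ringClassField K ι 1)) :
    ¬ IsSquare ((7 : ringClassField K ι 1) * ∏ τ ∈ S, τ (u : ringClassField K ι 1)) := by
  haveI : NumberField (ringClassField K ι 1) := numberField_ringClassField hK ι one_ne_zero
  ------------------------------------------------------------------ `K[1]/K` unramified at `v`; a prime `w ∣ v` with `e = 1`
  have hv1 : ¬ Ideal.span {((1 : ℕ) : 𝓞 K)} ≤ v.asIdeal := by
    rw [Nat.cast_one, Ideal.span_singleton_one, top_le_iff]
    exact v.isPrime.ne_top
  have hunr := isUnramifiedIn_ringClassField hK ι one_ne_zero hv1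
  haveI := v.isMaximal
  obtain ⟨W, hWmax, hWover⟩ :=
    Ideal.exists_maximal_ideal_liesOver_of_isIntegral (S := 𝓞 (ringClassField K ι 1)) v.asIdeal
  let w : HeightOneSpectrum (𝓞 (ringClassField K ι 1)) :=
    ⟨W, hWmax.isPrime, Ideal.ne_bot_of_liesOver_of_ne_bot v.ne_bot W⟩
  haveI : w.asIdeal.LiesOver v.asIdeal := hWover
  have he : v.asIdeal.ramificationIdx' w.asIdeal = 1 := by
    rw [Ideal.ramificationIdx'_eq_ramificationIdx v.asIdeal w.asIdeal v.ne_bot]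
    exact hunr.ramificationIdx_eq_one hWover
  ------------------------------------------------------------------ `w(7) = exp(−1)`
  have h1v : (1 : 𝓞 K) ∉ v.asIdeal := fun h ↦ v.isPrime.ne_top ((Ideal.eq_top_iff_one _).mpr h)
  have hval7 : v.valuation K (((7 : 𝓞 K) * 1 : 𝓞 K) : K) = exp (-1 : ℤ) :=
    valuation_mul_eq_exp_neg_one (K := K) v h7v h7v2 h1v
  have hw7 : w.valuation (ringClassField K ι 1) (7 : ringClassField K ι 1) = exp (-1 : ℤ) := by
    have h := HeightOneSpectrum.valuation_liesOver (K := K) (ringClassField K ι 1) v w (((7 : 𝓞 K) * 1 : 𝓞 K) : K)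
    rw [he, pow_one, hval7, show ((7 : 𝓞 K) * 1 : 𝓞 K) = 7 by norm_num, show (((7 : 𝓞 K)) : K) = 7 from rfl, map_ofNat] at h
    exact h.symm
  ------------------------------------------------------------------ each conjugate `τu` is a `w`-unit (else `v' ≤ v`)
  have hτu : ∀ τ : ringClassField K ι 1 ≃ₐ[K] ringClassField K ι 1,
      w.valuation (ringClassField K ι 1) (τ (u : ringClassField K ι 1)) = 1 := by
    intro τ
    have hnot : RingOfIntegers.mapAlgEquiv τ u ∉ w.asIdeal := by
      intro hmem
      apply hne
      have hle : v'.asIdeal ≤ v.asIdeal := by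
        intro z hz
        have h1 : algebraMap (𝓞 K) (𝓞 (ringClassField K ι 1)) z ∈ Ideal.span {u} := by
          rw [hspan]; exact Ideal.mem_map_of_mem _ hz
        obtain ⟨c, hc⟩ := Ideal.mem_span_singleton'.mp h1
        have h2 : RingOfIntegers.mapAlgEquiv τ (algebraMap (𝓞 K) (𝓞 (ringClassField K ι 1)) z) ∈ w.asIdeal := by
          rw [← hc, map_mul]; exact w.asIdeal.mul_mem_left _ hmem
        rw [AlgEquiv.commutes] at h2
        exact (Ideal.mem_of_liesOver w.asIdeal v.asIdeal z).mpr h2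
      exact ((v'.isMaximal).eq_of_le v.isPrime.ne_top hle).symm
    have h := (intValuation_eq_one_iff_mem_primeCompl w (RingOfIntegers.mapAlgEquiv τ u)).mpr hnot
    rw [← valuation_of_algebraMap (K := ringClassField K ι 1)] at h
    exact h
  ------------------------------------------------------------------ the valuation of `7 ∏ τu` is `exp(−1)`: odd
  refine not_isSquare_of_valuation_eq_exp_odd (ringClassField K ι 1) w (m := -1) (by decide) ?_
  rw [map_mul, map_prod, hw7, Finset.prod_eq_one (fun τ _ ↦ hτu τ), mul_one]

end RingClassField

/-! ## §3 The Heegner instance: `7 · ∏_{τ ∈ S} (τ x(y₁) − 2) ∉ K[1]^{×2}` -/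
section Heegner

variable {K : Type} [Field K] [NumberField K]

/-- **THE PARTIAL-NORM KEY LEMMA (Heegner instance).** `K` imaginary quadratic, `ι : K → ℂ`, `D₀` an optimal datum of `X₀(49)` (`|D₀.c| = 1`),
`d` Kolyvagin–Heegner data of conductor `1` (`d.y = y₁ ∈ X₀(49)(K[1])`). Granted (F-η), (F-D), (F-norm) BY NAME: `y₁ = (x₁, y₁)` is affine and
for EVERY finite set `S` of `K`-automorphisms of `K[1]`, **`7 · ∏_{τ ∈ S} (τ x₁ − 2)` is not a square in `K[1]`.** (`x₁ − 2 = η(τ_{Q'})/η(49τ_{Q'})`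
generates `𝔮̄′𝓞_{K[1]}`; the other prime `𝔮 ∋ 7` of `𝓞_K` is the one (F-norm) exhibits, `≠ 𝔮̄′` because `N(x₁ − 2) ∈ 𝔮̄′ ∖ 𝔮`; then §2.)
[cite: Lang1987, Ch. 12 §2 Thm. 4 and Thm. 5] [cite: Ligozat1975, Prop. 3.1.1 and table N = 49 (p. 45)] [cite: Gross1984, §§4–5] -/
theorem exists_heegner_x_not_isSquare_seven_mul_prod (hEta₀ : x049_x_sub_two_eq_etaQuotient)
    (hD : deuring_etaQuotient49_heegner_generates_conjPrime) (hEta : x049_heegner_norm_x_sub_two_not_mem)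
    (hK : IsImaginaryQuadratic K) (ι : K →+* ℂ) (D₀ : ModularParametrizationData cm7 49) (hc : |D₀.c| = 1) {β : ℤ}
    (d : KolyvaginHeegnerData D₀ β ι 1) [FiniteDimensional K (ringClassField K ι 1)] :
    ∃ (x₁ y₁ : ringClassField K ι 1) (h : (cm7.baseChange (ringClassField K ι 1)).toAffine.Nonsingular x₁ y₁),
      d.y = .some x₁ y₁ h ∧ ∀ S : Finset (ringClassField K ι 1 ≃ₐ[K] ringClassField K ι 1),
        ¬ IsSquare ((7 : ringClassField K ι 1) * ∏ τ ∈ S, (τ x₁ - 2)) := by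
  haveI : NumberField (ringClassField K ι 1) := numberField_ringClassField hK ι one_ne_zero
  haveI := (finiteDimensional_and_isGalois_ringClassField hK ι one_ne_zero).2
  ------------------------------------------------------------------ (F-D) at a representative `Q' ∼ Q₁`, (F-η) at `τ_{Q'}`
  obtain ⟨H, hHβ⟩ := nonempty_heegnerDatum_holds 49 K hK d.dvd_sq_sub
  have hQ₁ := heegnerFormOfConductor_mem_heegnerForms (N := 49) hK.discr_neg d.dvd_sq_sub one_ne_zero
  simp only [Nat.cast_one, one_pow, one_mul] at hQ₁
  obtain ⟨Q', hQ', γ, hγ⟩ := H.exists_isGamma0Equiv _ hQ₁.1 (by rw [hHβ]; exact hQ₁.2)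
  obtain ⟨u, v', hu, h7', hspan⟩ := hD K ι hK H Q' hQ'
  obtain ⟨yτ, hns, hφ⟩ := hEta₀ D₀ hc (heegnerTau Q')
  have hmap : Affine.Point.map (ringClassField K ι 1).subtype.toRatAlgHom d.y = D₀.φ (heegnerTau Q') := by
    rw [d.map_y, ← hγ, D₀.φ_gamma0_smul_holds']; rfl
  rw [hφ] at hmap
  ------------------------------------------------------------------ (F-norm): the affine coordinates and the other prime `v`
  obtain ⟨x₁, y₁, hxy, hdy, b, v, hnorm, h7v, h7v2, hbv⟩ := hEta K ι hK D₀ hc β d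
  rw [hdy, Affine.Point.map_some] at hmap
  have hx : ((x₁ : ringClassField K ι 1) : ℂ) =
      2 + ModularForm.eta (heegnerTau Q') / ModularForm.eta (UpperHalfPlane.ofComplex (49 * ((heegnerTau Q' : UpperHalfPlane) : ℂ))) :=
    ((Affine.Point.some.injEq _ _ _ _ _ _).mp hmap).1
  have hxu : x₁ - 2 = (u : ringClassField K ι 1) :=
    Subtype.ext (show (x₁ : ℂ) - 2 = ((u : ringClassField K ι 1) : ℂ) by rw [hx, hu]; ring)
  ------------------------------------------------------------------ `v ≠ v'`: `b = N(u) ∈ v'` but `b ∉ v`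
  have hne : v.asIdeal ≠ v'.asIdeal := by
    intro heq
    apply hbv
    rw [heq]
    -- `b = N(u)`
    have hb : ((b : 𝓞 K) : K) = ((RingOfIntegers.norm K u : 𝓞 K) : K) := by
      rw [← hnorm, hxu]
      exact (RingOfIntegers.coe_norm K u).symm
    have hb' : b = RingOfIntegers.norm K u := RingOfIntegers.coe_injective hb
    -- `N(u) = ∏_σ σu ∈ v'𝓞_{K[1]}` and `v' = v'𝓞 ∩ 𝓞_K` below a prime over `v'`
    haveI := v'.isMaximal
    obtain ⟨P, hPmax, hPover⟩ :=
      Ideal.exists_maximal_ideal_liesOver_of_isIntegral (S := 𝓞 (ringClassField K ι 1)) v'.asIdeal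
    haveI : P.LiesOver v'.asIdeal := hPover
    have huP : u ∈ P := by
      have h1 : u ∈ v'.asIdeal.map (algebraMap (𝓞 K) (𝓞 (ringClassField K ι 1))) := by
        rw [← hspan]; exact Ideal.mem_span_singleton_self u
      exact (Ideal.map_le_iff_le_comap.mpr (le_of_eq (Ideal.over_def P v'.asIdeal))) h1
    have hprod : algebraMap (𝓞 K) (𝓞 (ringClassField K ι 1)) (RingOfIntegers.norm K u) =
        ∏ σ : ringClassField K ι 1 ≃ₐ[K] ringClassField K ι 1, RingOfIntegers.mapAlgEquiv σ u := by
      apply RingOfIntegers.coe_injective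
      change ((algebraMap (𝓞 K) (𝓞 (ringClassField K ι 1)) (RingOfIntegers.norm K u) : ringClassField K ι 1)) = _
      rw [RingOfIntegers.coe_algebraMap_norm, Algebra.norm_eq_prod_automorphisms, map_prod]
      rfl
    have h1u : RingOfIntegers.mapAlgEquiv (1 : ringClassField K ι 1 ≃ₐ[K] ringClassField K ι 1) u = u :=
      RingOfIntegers.coe_injective rfl
    rw [hb', Ideal.mem_of_liesOver P v'.asIdeal, hprod,
      ← Finset.mul_prod_erase _ _ (Finset.mem_univ (1 : ringClassField K ι 1 ≃ₐ[K] ringClassField K ι 1)), h1u]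
    exact P.mul_mem_right _ huP
  ------------------------------------------------------------------ §2
  refine ⟨x₁, y₁, hxy, hdy, fun S ↦ ?_⟩
  have e : ∏ τ ∈ S, (τ x₁ - 2) = ∏ τ ∈ S, τ (u : ringClassField K ι 1) :=
    Finset.prod_congr rfl fun τ _ ↦ by rw [← hxu, map_sub, map_ofNat]
  rw [e]
  exact not_isSquare_seven_mul_prod_mapAlgEquiv hK ι u v' v hspan hne h7v h7v2 S

end Heegner

end Summit.BirchSwinnertonDyer.BirchSwinnertonDyer.Theorems.GoldfeldGoodTwists

end
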